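/-
Copyright (c) 2026 the pub-hodgecm-mathlib formalisation cell (harness21).  Prover seat hodgecm-mathlib-K2E3-p31 (g2) on LEAD F0P6-plan (g14) BATCH #164 (1) ∕
#170 (A), Track B «K2-LIT» ∕ hLiu418 #184♮ = `stmt-HodgeConjecture-24832`, F4 road (E), (E-d) pivot, input (R-grp) FILE (i): the archimedean ∕ finite COMPONENT
MATRICES of the partner embedding `k ↦ 1_𝔻 ⊗ k` (the right-leg twin of ★ K2E5-p16 `K2LiuArchTensorEmbArchComponent` + ★ K2Liu-p03 `K2LiuTensorEmbPlaceComponents`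
§1–§2 + ★ `K2LiuTensorEmbArchFinParts` §1).  Desk K2Liu-p27 (g2); consumer (R-grp) FILE (iii) `K2LiuArchPlaceSecJPartnerEmb`.  THEOREMS ONLY.
-/
import Summits.HodgeConjecture.HodgeConjecture.Theorems.K2LiuPartnerEmbedding            -- ★ p861304 `partnerEmb`, `coe_partnerEmb` (`reindex epsD (1 ⊗ₖ k)`, rfl)
import Summits.HodgeConjecture.HodgeConjecture.Theorems.K2LiuTensorEmbPlaceComponents     -- ★ the left-leg twins (`map_coe_tensorEmb`, …) — vocabulary and proof pattern
import Literature.NumberTheory.Automorphic.UnitaryGroupArchimedeanPlaces                   -- ★ `UnitaryGroup.archAt`, `coe_archAt`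
import HarnessLib

/-!
# Crux `HLiu418`, F4 (E-d) pivot, (R-grp) FILE (i): component matrices of the partner embedding `k ↦ 1_𝔻 ⊗ k`

Cell `hodgecm-mathlib`, crux item hLiu418 = `stmt-HodgeConjecture-24832` (helper lane `--supports`, count-neutral; closes no socket).

THE POINT.  The (E-d) pivot's group identity (R-grp) «`archEmb (placeSecJ_𝕎 σ (toBig (κ (1,k)), 1)) = partnerEmb (k̂ σ k)`» (F4 desk K2Liu-p27 (g2)
23:42:50Z; (π1) of LH7-p07 (g2)'s B3-b assembly) is the RIGHT-LEG twin of ★ K2E5-p16's (J2⊗-arch) chain for the left leg `h ↦ h ⊗ 1_{V′}`.  Its first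
input is this file: the matrix of ★ `partnerEmb k = reindex epsD (1_{n+n} ⊗ₖ k)` (★ `coe_partnerEmb`, `rfl`) is FUNCTORIAL IN THE COEFFICIENT RING, hence
* §1 `one_kronecker_map`, **`map_coe_partnerEmb`** — `(1 ⊗ k).map f = reindex epsD (1 ⊗ₖ (k.map f))` for every ring homomorphism `f` out of `𝔸_L`;
* §2 **`archPart_partnerEmb_eq_one`** (`k_∞ = 1 ⇒ (1 ⊗ k)_∞ = 1`), `coe_evalPlace_finPart_partnerEmb`, **`evalPlace_finPart_partnerEmb_eq_one`**
  (`k_w = 1 ⇒ (1 ⊗ k)_w = 1`), **`finPart_partnerEmb_eq_one`** (`k_f = 1 ⇒ (1 ⊗ k)_f = 1`), **`partnerEmb_archToAdelic`** (`1 ⊗ (a, 1) = ((1 ⊗ (a,1))_∞, 1)`: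
  the partner embedding of an archimedean element is archimedean);
* §3 **`coe_archPart_partnerEmb`** — `(1 ⊗ k)_∞ = reindex epsD (1 ⊗ₖ k_∞)` as matrices over `L ⊗ ℝ`; **`coe_archAt_archPart_partnerEmb`** — at every complex
  place `w`, `((1 ⊗ k)_∞)_w = reindex epsD (1 ⊗ₖ (k_∞)_w)` as complex matrices.
Every proof is the ★ left-leg proof with `(h.map f) ⊗ₖ 1` replaced by `1 ⊗ₖ (k.map f)` (★ `K2LiuTensorEmbPlaceComponents.archPart_tensorEmb_eq_one`,
`coe_evalPlace_finPart_tensorEmb`, ★ `K2LiuTensorEmbArchFinParts.finPart_tensorEmb_eq_one`, `tensorEmb_archToAdelic`, ★ `K2LiuArchTensorEmbArchComponent`).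
References: [Kudla1994] S. Kudla, Israel J. Math. 87 (1994) §2; [HarrisKudlaSweet1996] J. AMS 9 (1996) §1 (1.8); [BorelJacquet1979] Corvallis I §4.1;
[PlatonovRapinchuk1994] §5.1; [MoeglinVignerasWaldspurger1987] Ch. 1 I.17.
HONEST LABEL: HC_CM is proved only modulo the 7 printed citations (2 remaining named inputs: hLiu418 = stmt-HodgeConjecture-24832,
h413 = stmt-HodgeConjecture-24833) until rung 0 closes; count-neutral helper, closes no socket.
-/

set_option autoImplicit false
set_option linter.dupNamespace false -- the mandated namespace repeats `HodgeConjecture.HodgeConjecture`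

noncomputable section

open scoped Matrix Kronecker Classical
open NumberField NumberField.mixedEmbedding IsDedekindDomain

namespace Summit.HodgeConjecture.HodgeConjecture.Cruxes.HLiu418.K2LiuArchPartnerEmbArchComponent

open Literature.NumberTheory.Automorphic Literature.NumberTheory.Automorphic.UnitaryGroup Literature.NumberTheory.GaloisRepresentations
open Literature.NumberTheory.GelbartRogawski1991 Literature.NumberTheory.GelbartRogawski1991.UnitaryDualPair
open Literature.NumberTheory.GelbartRogawski1991.GRConstruction
open Literature.NumberTheory.K2Lit.SiegelDoubled
open Summit.HodgeConjecture.HodgeConjecture.Cruxes.HLiu418.K2LiuPartnerEmbedding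

variable (L : Type) [Field L] [NumberField L] [IsCMField L]
variable {N M n : ℕ} (e : Fin N × Fin M ≃ Fin n)
  (dV : Fin N → L) (hdV : ∀ i, IsCMField.complexConj L (dV i) = dV i)
  (dW : Fin M → L) (hdW : ∀ i, IsCMField.complexConj L (dW i) = dW i)
variable {M₂ M' n' : ℕ} (eW : Fin M × Fin M₂ ≃ Fin M') (e' : Fin N × Fin M' ≃ Fin n')
  (dV' : Fin M₂ → L) (hdV' : ∀ k, IsCMField.complexConj L (dV' k) = dV' k)

/-! ## §1 The matrix of `1 ⊗ k` is functorial in the coefficient ring -/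

omit [NumberField L] [IsCMField L] in
/-- `(1 ⊗ₖ A).map f = 1 ⊗ₖ (A.map f)` for a ring homomorphism `f`. [folklore] -/
theorem one_kronecker_map {R S : Type} [CommRing R] [CommRing S] (f : R →+* S) {m : ℕ} (k : ℕ)
    (A : Matrix (Fin m) (Fin m) R) :
    ((1 : Matrix (Fin k) (Fin k) R) ⊗ₖ A).map f = (1 : Matrix (Fin k) (Fin k) S) ⊗ₖ (A.map f) := by
  ext ⟨a, i⟩ ⟨b, j⟩
  simp only [Matrix.map_apply, Matrix.kroneckerMap_apply, Matrix.one_apply, map_mul]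
  split_ifs <;> simp

/-- **`(1 ⊗ k).map f = reindex epsD (1 ⊗ₖ (k.map f))`** for every ring homomorphism `f` out of `𝔸_L` (★ `coe_partnerEmb`).
[cite: Kudla1994, §2 (doubled space, Siegel parabolic)] [cite: HarrisKudlaSweet1996, §1 (1.8)] -/
theorem map_coe_partnerEmb {S : Type} [CommRing S] (f : AdeleRing (𝓞 L) L →+* S)
    (k : UnitaryGroup.adelic (Fp L) L (IsCMField.complexConj L) M₂ (Matrix.diagonal dV')) :
    (((partnerEmb L e dV hdV dW hdW eW e' dV' hdV' k : HA L e' dV hdV (tensorFrame L dW eW dV') (tensorFrame_real L dW hdW eW dV' hdV')) :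
        GL (Fin (n' + n')) (AdeleRing (𝓞 L) L)) : Matrix (Fin (n' + n')) (Fin (n' + n')) (AdeleRing (𝓞 L) L)).map f =
      Matrix.reindex (epsD e eW e') (epsD e eW e')
        ((1 : Matrix (Fin (n + n)) (Fin (n + n)) S) ⊗ₖ
          ((((k : UnitaryGroup.adelic (Fp L) L (IsCMField.complexConj L) M₂ (Matrix.diagonal dV')) : GL (Fin M₂) (AdeleRing (𝓞 L) L)) :
            Matrix (Fin M₂) (Fin M₂) (AdeleRing (𝓞 L) L)).map f)) := by
  rw [coe_partnerEmb, Matrix.reindex_apply, Matrix.reindex_apply, ← Matrix.submatrix_map, one_kronecker_map]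

/-! ## §2 Trivial place components are preserved; the partner embedding of an archimedean element is archimedean -/

/-- **`k_∞ = 1 ⇒ (1 ⊗ k)_∞ = 1`** (the `K_∞`-matrix of `1 ⊗ k` is `reindex epsD (1 ⊗ₖ k_∞)`). [cite: BorelJacquet1979, §4.1] [cite: Kudla1994, §2] -/
theorem archPart_partnerEmb_eq_one (k : UnitaryGroup.adelic (Fp L) L (IsCMField.complexConj L) M₂ (Matrix.diagonal dV'))
    (h₁ : UnitaryGroup.archPart (Fp L) L (IsCMField.complexConj L) M₂ (Matrix.diagonal dV') k = 1) :
    UnitaryGroup.archPart (Fp L) L (IsCMField.complexConj L) (n' + n') (hermD L e' dV hdV (tensorFrame L dW eW dV') (tensorFrame_real L dW hdW eW dV' hdV'))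
      (partnerEmb L e dV hdV dW hdW eW e' dV' hdV' k) = 1 := by
  -- `k_∞ = 1` as a statement about the `K_∞`-matrix of `k`
  have hy1 : GLn.fstHom M₂ L ((k : UnitaryGroup.adelic (Fp L) L (IsCMField.complexConj L) M₂ (Matrix.diagonal dV')) :
      GL (Fin M₂) (AdeleRing (𝓞 L) L)) = 1 := by
    have h' := congrArg Subtype.val h₁
    simp only [UnitaryGroup.coe_archPart, UnitaryGroup.adelicVal_apply, GLn.toMixed_apply, OneMemClass.coe_one] at h'
    exact (GLn.infiniteEquivMixed M₂ L).injective (h'.trans (map_one _).symm)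
  have hy2 : ((((k : UnitaryGroup.adelic (Fp L) L (IsCMField.complexConj L) M₂ (Matrix.diagonal dV')) : GL (Fin M₂) (AdeleRing (𝓞 L) L)) :
      Matrix (Fin M₂) (Fin M₂) (AdeleRing (𝓞 L) L)).map (UnitaryGroup.adeleFst L)) = 1 := by
    have h' := congrArg (fun u : GL (Fin M₂) (InfiniteAdeleRing L) => (u : Matrix (Fin M₂) (Fin M₂) (InfiniteAdeleRing L))) hy1
    rw [Units.val_one] at h'
    exact h'
  -- the `K_∞`-matrix of `1 ⊗ k` is `1`
  have hfst : GLn.fstHom (n' + n') L ((partnerEmb L e dV hdV dW hdW eW e' dV' hdV' k :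
      HA L e' dV hdV (tensorFrame L dW eW dV') (tensorFrame_real L dW hdW eW dV' hdV')) : GL (Fin (n' + n')) (AdeleRing (𝓞 L) L)) = 1 := by
    refine Units.ext ?_
    rw [Units.val_one]
    change ((((partnerEmb L e dV hdV dW hdW eW e' dV' hdV' k : HA L e' dV hdV (tensorFrame L dW eW dV') (tensorFrame_real L dW hdW eW dV' hdV')) :
        GL (Fin (n' + n')) (AdeleRing (𝓞 L) L)) : Matrix (Fin (n' + n')) (Fin (n' + n')) (AdeleRing (𝓞 L) L)).map (UnitaryGroup.adeleFst L)) = 1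
    rw [map_coe_partnerEmb, hy2, Matrix.one_kronecker_one, Matrix.reindex_apply, Matrix.submatrix_one_equiv]
  refine Subtype.ext ?_
  rw [UnitaryGroup.coe_archPart, UnitaryGroup.adelicVal_apply, GLn.toMixed_apply, hfst, map_one, OneMemClass.coe_one]

/-- the `w′`-component matrix of `((1 ⊗ k)_f)_w` is `reindex epsD (1 ⊗ₖ (k_{w′}))`. [cite: PlatonovRapinchuk1994, §5.1] [cite: Kudla1994, §2] -/
theorem coe_evalPlace_finPart_partnerEmb (w : HeightOneSpectrum (𝓞 (Fp L))) (w' : UnitaryGroup.PlacesOver L w)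
    (k : UnitaryGroup.adelic (Fp L) L (IsCMField.complexConj L) M₂ (Matrix.diagonal dV')) :
    (((UnitaryGroup.evalPlace (Fp L) L (IsCMField.complexConj L) (n' + n') (hermD L e' dV hdV (tensorFrame L dW eW dV') (tensorFrame_real L dW hdW eW dV' hdV')) w
        (UnitaryGroup.finPart (Fp L) L (IsCMField.complexConj L) (n' + n') (hermD L e' dV hdV (tensorFrame L dW eW dV') (tensorFrame_real L dW hdW eW dV' hdV'))
          (partnerEmb L e dV hdV dW hdW eW e' dV' hdV' k)) :
        UnitaryGroup.localPi L (IsCMField.complexConj L) (n' + n') (hermD L e' dV hdV (tensorFrame L dW eW dV') (tensorFrame_real L dW hdW eW dV' hdV')) w) :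
        UnitaryGroup.LocalGLPi L (n' + n') w) w' : Matrix (Fin (n' + n')) (Fin (n' + n')) (w'.1.adicCompletion L)) =
      Matrix.reindex (epsD e eW e') (epsD e eW e')
        ((1 : Matrix (Fin (n + n)) (Fin (n + n)) (w'.1.adicCompletion L)) ⊗ₖ
          (((UnitaryGroup.evalPlace (Fp L) L (IsCMField.complexConj L) M₂ (Matrix.diagonal dV') w
            (UnitaryGroup.finPart (Fp L) L (IsCMField.complexConj L) M₂ (Matrix.diagonal dV') k) :
            UnitaryGroup.localPi L (IsCMField.complexConj L) M₂ (Matrix.diagonal dV') w) : UnitaryGroup.LocalGLPi L M₂ w) w' :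
            Matrix (Fin M₂) (Fin M₂) (w'.1.adicCompletion L))) := by
  rw [UnitaryGroup.coe_evalPlace_apply, UnitaryGroup.coe_evalPlace_apply, UnitaryGroup.coe_finPart, UnitaryGroup.coe_finPart,
    UnitaryGroup.adelicVal_apply, UnitaryGroup.adelicVal_apply]
  have key : ∀ (G : GL (Fin (n' + n')) (AdeleRing (𝓞 L) L)),
      ((GLn.evalAt (n' + n') L w'.1 (GLn.sndHom (n' + n') L G) : GL (Fin (n' + n')) (w'.1.adicCompletion L)) :
          Matrix (Fin (n' + n')) (Fin (n' + n')) (w'.1.adicCompletion L)) =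
        (G : Matrix (Fin (n' + n')) (Fin (n' + n')) (AdeleRing (𝓞 L) L)).map
          ((AdelicGroupData.finiteAdeleEval L w'.1).comp (UnitaryGroup.adeleSnd L)) := by
    intro G
    ext i j
    rfl
  have key' : ∀ (G : GL (Fin M₂) (AdeleRing (𝓞 L) L)),
      ((GLn.evalAt M₂ L w'.1 (GLn.sndHom M₂ L G) : GL (Fin M₂) (w'.1.adicCompletion L)) : Matrix (Fin M₂) (Fin M₂) (w'.1.adicCompletion L)) =
        (G : Matrix (Fin M₂) (Fin M₂) (AdeleRing (𝓞 L) L)).map ((AdelicGroupData.finiteAdeleEval L w'.1).comp (UnitaryGroup.adeleSnd L)) := by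
    intro G
    ext i j
    rfl
  rw [key, key']
  exact map_coe_partnerEmb L e dV hdV dW hdW eW e' dV' hdV' _ k

/-- **`k_w = 1 ⇒ (1 ⊗ k)_w = 1`**. [cite: PlatonovRapinchuk1994, §5.1] [cite: BorelJacquet1979, §4.1] -/
theorem evalPlace_finPart_partnerEmb_eq_one (w : HeightOneSpectrum (𝓞 (Fp L)))
    (k : UnitaryGroup.adelic (Fp L) L (IsCMField.complexConj L) M₂ (Matrix.diagonal dV'))
    (hw : UnitaryGroup.evalPlace (Fp L) L (IsCMField.complexConj L) M₂ (Matrix.diagonal dV') w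
      (UnitaryGroup.finPart (Fp L) L (IsCMField.complexConj L) M₂ (Matrix.diagonal dV') k) = 1) :
    UnitaryGroup.evalPlace (Fp L) L (IsCMField.complexConj L) (n' + n') (hermD L e' dV hdV (tensorFrame L dW eW dV') (tensorFrame_real L dW hdW eW dV' hdV')) w
      (UnitaryGroup.finPart (Fp L) L (IsCMField.complexConj L) (n' + n') (hermD L e' dV hdV (tensorFrame L dW eW dV') (tensorFrame_real L dW hdW eW dV' hdV'))
        (partnerEmb L e dV hdV dW hdW eW e' dV' hdV' k)) = 1 := by
  refine Subtype.ext (funext fun w' => Units.ext ?_)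
  rw [coe_evalPlace_finPart_partnerEmb, hw]
  simp only [OneMemClass.coe_one, Pi.one_apply, Units.val_one, Matrix.one_kronecker_one, Matrix.reindex_apply,
    Matrix.submatrix_one_equiv]

/-- **`k_f = 1 ⇒ (1 ⊗ k)_f = 1`** (place by place, assembled by ★ `eq_of_forall_evalPlace_eq`). [cite: BorelJacquet1979, §4.1] [cite: PlatonovRapinchuk1994, §5.1] -/
theorem finPart_partnerEmb_eq_one (k : UnitaryGroup.adelic (Fp L) L (IsCMField.complexConj L) M₂ (Matrix.diagonal dV'))
    (h₁ : UnitaryGroup.finPart (Fp L) L (IsCMField.complexConj L) M₂ (Matrix.diagonal dV') k = 1) :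
    UnitaryGroup.finPart (Fp L) L (IsCMField.complexConj L) (n' + n') (hermD L e' dV hdV (tensorFrame L dW eW dV') (tensorFrame_real L dW hdW eW dV' hdV'))
      (partnerEmb L e dV hdV dW hdW eW e' dV' hdV' k) = 1 :=
  UnitaryGroup.eq_of_forall_evalPlace_eq _ _ _ _ _ fun w =>
    (evalPlace_finPart_partnerEmb_eq_one L e dV hdV dW hdW eW e' dV' hdV' w k (by rw [h₁, map_one])).trans (map_one _).symm

/-- **`1 ⊗ (a, 1) = ((1 ⊗ (a, 1))_∞, 1)`**: the partner embedding of an archimedean element is archimedean (`finPart_partnerEmb_eq_one`, ★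
`archToAdelic_mul_finAdelicToAdelic`). [cite: BorelJacquet1979, §4.1] [cite: Kudla1994, §2] -/
theorem partnerEmb_archToAdelic (a : UnitaryGroup.arch (Fp L) L (IsCMField.complexConj L) M₂ (Matrix.diagonal dV')) :
    partnerEmb L e dV hdV dW hdW eW e' dV' hdV' (UnitaryGroup.archToAdelic (Fp L) L (IsCMField.complexConj L) M₂ (Matrix.diagonal dV') a) =
      UnitaryGroup.archToAdelic (Fp L) L (IsCMField.complexConj L) (n' + n') (hermD L e' dV hdV (tensorFrame L dW eW dV') (tensorFrame_real L dW hdW eW dV' hdV'))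
        (UnitaryGroup.archPart (Fp L) L (IsCMField.complexConj L) (n' + n') (hermD L e' dV hdV (tensorFrame L dW eW dV') (tensorFrame_real L dW hdW eW dV' hdV'))
          (partnerEmb L e dV hdV dW hdW eW e' dV' hdV' (UnitaryGroup.archToAdelic (Fp L) L (IsCMField.complexConj L) M₂ (Matrix.diagonal dV') a))) := by
  have h1 := finPart_partnerEmb_eq_one L e dV hdV dW hdW eW e' dV' hdV'
    (UnitaryGroup.archToAdelic (Fp L) L (IsCMField.complexConj L) M₂ (Matrix.diagonal dV') a)
    (UnitaryGroup.finPart_archToAdelic (Fp L) L (IsCMField.complexConj L) M₂ (Matrix.diagonal dV') a)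
  have h := UnitaryGroup.archToAdelic_mul_finAdelicToAdelic (Fp L) L (IsCMField.complexConj L) (n' + n')
    (hermD L e' dV hdV (tensorFrame L dW eW dV') (tensorFrame_real L dW hdW eW dV' hdV'))
    (partnerEmb L e dV hdV dW hdW eW e' dV' hdV' (UnitaryGroup.archToAdelic (Fp L) L (IsCMField.complexConj L) M₂ (Matrix.diagonal dV') a))
  rw [h1, map_one, mul_one] at h
  exact h.symm

/-! ## §3 The archimedean component matrices -/

/-- **THE `K_∞`-MATRIX OF `(1 ⊗ k)_∞` IS `reindex epsD (1 ⊗ₖ k_∞)`** (`map_coe_partnerEmb` along `ringEquiv_mixedSpace ∘ fst`; ★ `coe_archPart_apply` is `rfl`).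
[cite: Kudla1994, §2 (doubled space, Siegel parabolic)] [cite: BorelJacquet1979, §4.1] -/
theorem coe_archPart_partnerEmb (k : UnitaryGroup.adelic (Fp L) L (IsCMField.complexConj L) M₂ (Matrix.diagonal dV')) :
    (((UnitaryGroup.archPart (Fp L) L (IsCMField.complexConj L) (n' + n')
        (hermD L e' dV hdV (tensorFrame L dW eW dV') (tensorFrame_real L dW hdW eW dV' hdV'))
        (partnerEmb L e dV hdV dW hdW eW e' dV' hdV' k) :
          UnitaryGroup.arch (Fp L) L (IsCMField.complexConj L) (n' + n')
            (hermD L e' dV hdV (tensorFrame L dW eW dV') (tensorFrame_real L dW hdW eW dV' hdV'))) :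
          GL (Fin (n' + n')) (mixedSpace L)) : Matrix (Fin (n' + n')) (Fin (n' + n')) (mixedSpace L)) =
      Matrix.reindex (epsD e eW e') (epsD e eW e')
        ((1 : Matrix (Fin (n + n)) (Fin (n + n)) (mixedSpace L)) ⊗ₖ
          (((UnitaryGroup.archPart (Fp L) L (IsCMField.complexConj L) M₂ (Matrix.diagonal dV') k :
            UnitaryGroup.arch (Fp L) L (IsCMField.complexConj L) M₂ (Matrix.diagonal dV')) : GL (Fin M₂) (mixedSpace L)) :
              Matrix (Fin M₂) (Fin M₂) (mixedSpace L))) := by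
  have h := map_coe_partnerEmb L e dV hdV dW hdW eW e' dV' hdV'
    (((InfiniteAdeleRing.ringEquiv_mixedSpace L).toRingHom).comp (UnitaryGroup.adeleFst L)) k
  exact h

/-- **AT A COMPLEX PLACE `w`, THE MATRIX OF `((1 ⊗ k)_∞)_w` IS `reindex epsD (1 ⊗ₖ (k_∞)_w)`** (★ `coe_archAt` + the previous lemma + `one_kronecker_map`).
[cite: BorelJacquet1979, §4.1] [cite: Kudla1994, §2 (doubled space, Siegel parabolic)] -/
theorem coe_archAt_archPart_partnerEmb (k : UnitaryGroup.adelic (Fp L) L (IsCMField.complexConj L) M₂ (Matrix.diagonal dV'))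
    (w : {w : InfinitePlace L // w.IsComplex}) :
    (((UnitaryGroup.archAt (Fp L) L (IsCMField.complexConj L) (n' + n')
        (hermD L e' dV hdV (tensorFrame L dW eW dV') (tensorFrame_real L dW hdW eW dV' hdV')) w
        (complexConj_smul_infinitePlace L w.1) (IsCMField.complexConj_ne_one L)
        (UnitaryGroup.archPart (Fp L) L (IsCMField.complexConj L) (n' + n')
          (hermD L e' dV hdV (tensorFrame L dW eW dV') (tensorFrame_real L dW hdW eW dV' hdV'))
          (partnerEmb L e dV hdV dW hdW eW e' dV' hdV' k)) :
          UnitaryGroup.archLocal L (n' + n') (hermD L e' dV hdV (tensorFrame L dW eW dV') (tensorFrame_real L dW hdW eW dV' hdV')) w) :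
          GL (Fin (n' + n')) ℂ) : Matrix (Fin (n' + n')) (Fin (n' + n')) ℂ) =
      Matrix.reindex (epsD e eW e') (epsD e eW e')
        ((1 : Matrix (Fin (n + n)) (Fin (n + n)) ℂ) ⊗ₖ
          (((UnitaryGroup.archAt (Fp L) L (IsCMField.complexConj L) M₂ (Matrix.diagonal dV') w
            (complexConj_smul_infinitePlace L w.1) (IsCMField.complexConj_ne_one L)
            (UnitaryGroup.archPart (Fp L) L (IsCMField.complexConj L) M₂ (Matrix.diagonal dV') k) :
              UnitaryGroup.archLocal L M₂ (Matrix.diagonal dV') w) : GL (Fin M₂) ℂ) : Matrix (Fin M₂) (Fin M₂) ℂ)) := by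
  rw [UnitaryGroup.coe_archAt, UnitaryGroup.coe_archAt]
  change (((UnitaryGroup.archPart (Fp L) L (IsCMField.complexConj L) (n' + n')
        (hermD L e' dV hdV (tensorFrame L dW eW dV') (tensorFrame_real L dW hdW eW dV' hdV'))
        (partnerEmb L e dV hdV dW hdW eW e' dV' hdV' k) :
          UnitaryGroup.arch (Fp L) L (IsCMField.complexConj L) (n' + n')
            (hermD L e' dV hdV (tensorFrame L dW eW dV') (tensorFrame_real L dW hdW eW dV' hdV'))) :
          GL (Fin (n' + n')) (mixedSpace L)) : Matrix (Fin (n' + n')) (Fin (n' + n')) (mixedSpace L)).map (evalC L w) =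
      Matrix.reindex (epsD e eW e') (epsD e eW e')
        ((1 : Matrix (Fin (n + n)) (Fin (n + n)) ℂ) ⊗ₖ
          ((((UnitaryGroup.archPart (Fp L) L (IsCMField.complexConj L) M₂ (Matrix.diagonal dV') k :
            UnitaryGroup.arch (Fp L) L (IsCMField.complexConj L) M₂ (Matrix.diagonal dV')) : GL (Fin M₂) (mixedSpace L)) :
              Matrix (Fin M₂) (Fin M₂) (mixedSpace L)).map (evalC L w)))
  rw [coe_archPart_partnerEmb, Matrix.reindex_apply, Matrix.reindex_apply, ← Matrix.submatrix_map, one_kronecker_map]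

end Summit.HodgeConjecture.HodgeConjecture.Cruxes.HLiu418.K2LiuArchPartnerEmbArchComponent

end
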